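import Summits.MatrixMultiplication.MatrixMultiplication.Theorems.EdgePencilSixthConvexity
import HarnessLib

/-!
# The sixth-edge ladder is the family of UNBALANCED tetrahedron–diamond Kronecker products:
# `χ(δ)` = exponent of `T(K₄)_{⌈n^δ⌉} ⊠ D_{⌈n^{1−δ}⌉}`

Support kernel for `stmt-MatrixMultiplication-26697` (`TetraExcessZero : ω(K₄) ≤ ω(2,1,2)`, the
attacked leaf of route `TetrahedronCarving`; lineage `decomp-mm-lens-6` «barrier-complement carving»,
generation 25). Companion of `EdgePencilSixthKronecker` (K1: the Kronecker product IN THE BOND,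
`R₄(W_{N·M}^{(e₁e₂)}) ≤ R₄(W_N^{(e₁)})·R₄(W_M^{(e₂)})`) and `EdgePencilSixthConvexity` (K2: `χ` convex,
`TetraExcessZero ⟺ SixRungPos ∧ MidTight`); continued in `EdgePencilSixthCertificates` (the two pieces
as de-multiplication / absorption, all-or-nothing of absolute certificates, the quadratic world).
No item is added or changed; no definition.

NOTATION. `W_n^{(e)} = sixTetra F n e` (tetrahedron with bond `e` on edge `01`), `T(K₄)_n = W_n^{(n)}`
(`sixTetra_of_le`), `D_n = W_n^{(1)} = pencil F n n` the diamond (`sixTetra_one`); `χ = omegaSix F`,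
`ψ = ω(2,1,2) = χ(0)`, `T = ω(K₄) = χ(1)`; `A ⊠ B` is the Kronecker product of two `K₄`-tensors at
levels `N`, `M`, written pointwise `i ↦ A(K₁ ∘ i) · B(K₂ ∘ i)` at level `N·M`
(`TetrahedronTensorKronecker.K₁/K₂`, `tetra_mul_apply`).

* §1 Relabelling edge `01` is a GROUP ACTION (`relab₀₁_relab₀₁`, `relab₀₁_one`), so K1's pullback
  identity is an identity of tensors up to an invertible relabelling, and the Kronecker product in the
  bond is an EQUALITY of ranks: `R₄(W_N^{(e₁)} ⊠ W_M^{(e₂)}) = R₄(W_{N·M}^{(e₁e₂)})`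
  (`tensorRankD_sixKron_eq`, `e₁ ≤ N`, `e₂ ≤ M`). Instances: `R₄(T(K₄)_N ⊠ D_M) = R₄(W_{N·M}^{(N)})`
  (`tensorRankD_tetra_kron_pencil`) and `R₄(D_N ⊠ D_M) = R₄(D_{N·M})` (`tensorRankD_pencil_kron_pencil`).
* §2 Hence **the ladder is the family of unbalanced products**: for `δ ∈ [0,1]` the admissible
  exponents of `n ↦ W_n^{(⌈n^δ⌉)}` are exactly those of `n ↦ T(K₄)_{⌈n^δ⌉} ⊠ D_{⌈n^{1−δ}⌉}`
  (`sixAdmissibleExponents_eq_unbalanced`, `…_eq_tetra_kron_pencil`): `χ(δ)` is the exponent (base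
  `n`) of a SMALL tetrahedron times a LARGE diamond, of sizes `n^δ` and `n^{1−δ}`; endpoints `D_n`
  (`ψ`) and `T(K₄)_n` (`T`), midpoint the balanced pair `T(K₄)_k ⊠ D_k` (`2χ(1/2)` in base `k`).
  K2's chord `χ(δ) ≤ δT + (1−δ)ψ` is sub-multiplicativity of rank on this product, nothing else; the
  two pieces of «rung-and-chord» become statements about ONE pair of tensors (companion file):
  `MidTight ⟺` the exponent is additive on (tetrahedron, diamond); `SixRungPos ⟺` next to a
  polynomially larger diamond a small tetrahedron costs no more than a small diamond.

References: Christandl–Vrana–Zuiddam, arXiv:1609.07476, §1.1 (graph tensors with non-uniform bonds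
multiply edge-wise under `⊠`), Prop. 1.1.16 [ChristandlVranaZuiddam2016]; Bürgisser–Clausen–Shokrollahi,
Algebraic Complexity Theory, §15.5 (rank under `⊠`) [BurgisserClausenShokrollahi1997]; Lotti–Romani
1983 §1 [LottiRomani1983]. No `sorry`, no new axiom, no instance, no notation, no definition.
-/

noncomputable section

set_option linter.dupNamespace false

open Filter Asymptotics Finset Literature.Computability.AlgebraicComplexity
open Summit.MatrixMultiplication.MatrixMultiplication.Theorems.TetrahedronTensor
open Summit.MatrixMultiplication.MatrixMultiplication.Theorems.TetraDiagonal
open Summit.MatrixMultiplication.MatrixMultiplication.Theses.TetrahedronCarving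

namespace Summit.MatrixMultiplication.MatrixMultiplication.Theorems.EdgePencil

/-! ## §1 Relabelling is a group action; the Kronecker product in the bond is a rank EQUALITY -/

section Action

/-- Per-edge relabellings compose: `edgeRelab σ ∘ edgeRelab τ = edgeRelab (στ)` edge by edge. [folklore] -/
theorem edgeRelab_edgeRelab {n : ℕ} (σ τ : Equiv.Perm (Fin n)) (k : Fin 6) (y : Fin n) :
    edgeRelab σ k (edgeRelab τ k y) = edgeRelab (σ * τ) k y := by
  by_cases hk : k = 0
  · subst hk
    simp [edgeRelab]
  · simp [edgeRelab, Function.update_of_ne hk]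

/-- The identity permutation relabels nothing. [folklore] -/
theorem edgeRelab_one {n : ℕ} (k : Fin 6) (y : Fin n) :
    edgeRelab (1 : Equiv.Perm (Fin n)) k y = y := by
  by_cases hk : k = 0
  · subst hk
    simp [edgeRelab]
  · simp [edgeRelab, Function.update_of_ne hk]

/-- **The leg relabellings form an action**: `relab₀₁ σ v ∘ relab₀₁ τ v = relab₀₁ (στ) v`. [folklore] -/
theorem relab₀₁_relab₀₁ {n : ℕ} (σ τ : Equiv.Perm (Fin n)) (v : Fin 4) (x : Fin (n ^ 3)) :
    relab₀₁ σ v (relab₀₁ τ v x) = relab₀₁ (σ * τ) v x := by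
  simp only [relab₀₁, Equiv.symm_apply_apply, edgeRelab_edgeRelab]

/-- `relab₀₁ 1 v = id`. [folklore] -/
theorem relab₀₁_one {n : ℕ} (v : Fin 4) (x : Fin (n ^ 3)) :
    relab₀₁ (1 : Equiv.Perm (Fin n)) v x = x := by
  simp [relab₀₁, edgeRelab_one]

/-- `relab₀₁ σ v ∘ relab₀₁ σ⁻¹ v = id`. [folklore] -/
theorem relab₀₁_relab₀₁_inv {n : ℕ} (σ : Equiv.Perm (Fin n)) (v : Fin 4) (x : Fin (n ^ 3)) :
    relab₀₁ σ v (relab₀₁ σ⁻¹ v x) = x := by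
  rw [relab₀₁_relab₀₁, mul_inv_cancel, relab₀₁_one]

/-- `relab₀₁ σ⁻¹ v ∘ relab₀₁ σ v = id`. [folklore] -/
theorem relab₀₁_inv_relab₀₁ {n : ℕ} (σ : Equiv.Perm (Fin n)) (v : Fin 4) (x : Fin (n ^ 3)) :
    relab₀₁ σ⁻¹ v (relab₀₁ σ v x) = x := by
  rw [relab₀₁_relab₀₁, inv_mul_cancel, relab₀₁_one]

end Action

section KronEq

variable {F : Type*} [Field F]

/-- **The Kronecker product in the bond IS a relabelled `W_{N·M}^{(e₁e₂)}`** (K1's pullback identity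
`sixKron_pullback_apply` transported along the inverse box relabelling):
`W_N^{(e₁)} ⊠ W_M^{(e₂)} = W_{N·M}^{(e₁e₂)} ∘ relab₀₁ σ⁻¹`.
[cite: ChristandlVranaZuiddam2016, §1.1 (graph tensors multiply under ⊠)] -/
theorem sixKron_eq_pullback_inv {N M e₁ e₂ : ℕ} (σ : Equiv.Perm (Fin (N * M)))
    (hσ : ∀ z : Fin (N * M),
      ((((finProdFinEquiv.symm (σ z)).1 : Fin N) : ℕ) < e₁ ∧
          (((finProdFinEquiv.symm (σ z)).2 : Fin M) : ℕ) < e₂) ↔ (z : ℕ) < e₁ * e₂) :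
    (fun i : Fin 4 → Fin ((N * M) ^ 3) =>
        sixTetra F N e₁ (fun v => K₁ (i v)) * sixTetra F M e₂ (fun v => K₂ (i v))) =
      fun x : Fin 4 → Fin ((N * M) ^ 3) =>
        sixTetra F (N * M) (e₁ * e₂) (fun v => relab₀₁ σ⁻¹ v (x v)) := by
  funext x
  have h := sixKron_pullback_apply (F := F) σ hσ (fun v => relab₀₁ σ⁻¹ v (x v))
  simpa only [relab₀₁_relab₀₁_inv] using h

/-- **Kronecker in the bond, as an EQUALITY of ranks**:
`R₄(W_N^{(e₁)} ⊠ W_M^{(e₂)}) = R₄(W_{N·M}^{(e₁e₂)})` for `e₁ ≤ N`, `e₂ ≤ M` (each side is a pullback of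
the other along a bijective relabelling; K1 proved `≥`).
[cite: ChristandlVranaZuiddam2016, Prop. 1.1.16 (proof)] -/
theorem tensorRankD_sixKron_eq {N M e₁ e₂ : ℕ} (h₁ : e₁ ≤ N) (h₂ : e₂ ≤ M) :
    tensorRankD (fun i : Fin 4 → Fin ((N * M) ^ 3) =>
        sixTetra F N e₁ (fun v => K₁ (i v)) * sixTetra F M e₂ (fun v => K₂ (i v))) =
      tensorRankD (sixTetra F (N * M) (e₁ * e₂)) := by
  classical
  obtain ⟨σ, hσ⟩ := exists_perm_box h₁ h₂
  refine le_antisymm ?_ ?_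
  · exact (congrArg tensorRankD (sixKron_eq_pullback_inv (F := F) σ hσ)).trans_le
      (tensorRankD_pullback_le _ (fun v y => relab₀₁ σ⁻¹ v y) (sixTetra_decomposable _ _))
  · obtain ⟨u₁, hu₁⟩ := exists_rankOne_decomposition_sixTetra (F := F) N e₁
    obtain ⟨u₂, hu₂⟩ := exists_rankOne_decomposition_sixTetra (F := F) M e₂
    obtain ⟨u, hu⟩ := exists_rankOne_decomposition_mulK hu₁ hu₂
    have key : sixTetra F (N * M) (e₁ * e₂) = fun x : Fin 4 → Fin ((N * M) ^ 3) =>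
        (fun i : Fin 4 → Fin ((N * M) ^ 3) =>
          sixTetra F N e₁ (fun v => K₁ (i v)) * sixTetra F M e₂ (fun v => K₂ (i v)))
          (fun v => relab₀₁ σ v (x v)) := by
      funext x
      exact (sixKron_pullback_apply σ hσ x).symm
    rw [key]
    exact tensorRankD_pullback_le _ (fun v y => relab₀₁ σ v y)
      ⟨_, fun k => rankOneTensor (u k), fun k => rankOneTensor_mem _, hu⟩

/-- **Small tetrahedron times large diamond**: `R₄(T(K₄)_N ⊠ D_M) = R₄(W_{N·M}^{(N)})` (`M ≥ 1`;
`T(K₄)_N = W_N^{(N)}`, `D_M = W_M^{(1)}`). [cite: ChristandlVranaZuiddam2016, Prop. 1.1.16 (proof)] -/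
theorem tensorRankD_tetra_kron_pencil (N M : ℕ) (hM : 1 ≤ M) :
    tensorRankD (fun i : Fin 4 → Fin ((N * M) ^ 3) =>
        tetra F N (fun v => K₁ (i v)) * pencil F M M (fun v => K₂ (i v))) =
      tensorRankD (sixTetra F (N * M) N) := by
  have h := tensorRankD_sixKron_eq (F := F) (le_refl N) hM
  rw [sixTetra_of_le (F := F) (le_refl N), sixTetra_one, mul_one] at h
  exact h

/-- **Diamonds multiply to diamonds**: `R₄(D_N ⊠ D_M) = R₄(D_{N·M})` (`N, M ≥ 1`).
[cite: ChristandlVranaZuiddam2016, Prop. 1.1.16 (proof)] -/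
theorem tensorRankD_pencil_kron_pencil {N M : ℕ} (hN : 1 ≤ N) (hM : 1 ≤ M) :
    tensorRankD (fun i : Fin 4 → Fin ((N * M) ^ 3) =>
        pencil F N N (fun v => K₁ (i v)) * pencil F M M (fun v => K₂ (i v))) =
      tensorRankD (pencil F (N * M) (N * M)) := by
  have h := tensorRankD_sixKron_eq (F := F) hN hM
  simp only [sixTetra_one, mul_one] at h
  exact h

end KronEq

/-! ## §2 The ladder is the family of unbalanced tetrahedron–diamond products -/

section Unbalanced

variable (F : Type) [Field F]

/-- **`χ(δ)` is the exponent of `W_{⌈n^δ⌉⌈n^{1−δ}⌉}^{(⌈n^δ⌉)}`** (`δ ∈ [0,1]`): the admissible exponents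
of `n ↦ W_n^{(⌈n^δ⌉)}` and of `n ↦ W_{N·M}^{(N)}`, `N = ⌈n^δ⌉`, `M = ⌈n^{1−δ}⌉`, coincide
(`n ≤ NM ≤ 4n`, level and bond monotonicity). [cite: LottiRomani1983, §1 (p. 173)] -/
theorem sixAdmissibleExponents_eq_unbalanced {δ : ℝ} (hδ0 : 0 ≤ δ) (hδ1 : δ ≤ 1) :
    sixAdmissibleExponents F δ =
      {β : ℝ | (fun n : ℕ =>
          (tensorRankD (sixTetra F (rectDim n δ * rectDim n (1 - δ)) (rectDim n δ)) : ℝ)) =O[atTop]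
        fun n : ℕ => (n : ℝ) ^ β} := by
  ext β
  refine ⟨fun hβ => ?_, fun hβ => ?_⟩
  · have hβ0 : 0 ≤ β := nonneg_of_mem_sixAdmissibleExponents F hβ
    obtain ⟨C, hC0, hC⟩ := exists_bound_of_mem_sixAdmissibleExponents F hβ
    refine IsBigO.of_bound (C * (4 : ℝ) ^ β) ?_
    filter_upwards [eventually_ge_atTop 1] with n hn
    have hn0 : (0 : ℝ) < n := by exact_mod_cast hn
    rw [Real.norm_of_nonneg (Nat.cast_nonneg _), Real.norm_of_nonneg (Real.rpow_nonneg hn0.le _)]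
    have hNle : (rectDim n δ : ℝ) ≤ 2 * (n : ℝ) ^ δ := by
      simpa [max_eq_left hδ0] using rectDim_le hn δ
    have hMle : (rectDim n (1 - δ) : ℝ) ≤ 2 * (n : ℝ) ^ (1 - δ) := by
      simpa [max_eq_left (sub_nonneg.2 hδ1)] using rectDim_le hn (1 - δ)
    have hNM : rectDim n δ * rectDim n (1 - δ) ≤ 4 * n := by
      have h : ((rectDim n δ * rectDim n (1 - δ) : ℕ) : ℝ) ≤ ((4 * n : ℕ) : ℝ) := by
        push_cast
        calc (rectDim n δ : ℝ) * (rectDim n (1 - δ) : ℝ)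
            ≤ (2 * (n : ℝ) ^ δ) * (2 * (n : ℝ) ^ (1 - δ)) :=
              mul_le_mul hNle hMle (Nat.cast_nonneg _) (by positivity)
          _ = 4 * (n : ℝ) := by
              rw [mul_mul_mul_comm, ← Real.rpow_add hn0, add_sub_cancel, Real.rpow_one]
              norm_num
      exact_mod_cast h
    have h4n : 1 ≤ 4 * n := by omega
    have hbond : rectDim n δ ≤ rectDim (4 * n) δ :=
      Nat.ceil_mono (Real.rpow_le_rpow (Nat.cast_nonneg _)
        (by exact_mod_cast (show n ≤ 4 * n by omega)) hδ0)
    have hnat : tensorRankD (sixTetra F (rectDim n δ * rectDim n (1 - δ)) (rectDim n δ)) ≤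
        tensorRankD (sixTetra F (4 * n) (rectDim (4 * n) δ)) :=
      (tensorRankD_sixTetra_mono_level hNM _).trans (tensorRankD_sixTetra_mono hbond)
    calc (tensorRankD (sixTetra F (rectDim n δ * rectDim n (1 - δ)) (rectDim n δ)) : ℝ)
        ≤ tensorRankD (sixTetra F (4 * n) (rectDim (4 * n) δ)) := by exact_mod_cast hnat
      _ ≤ C * ((4 * n : ℕ) : ℝ) ^ β := hC _ h4n
      _ = C * (4 : ℝ) ^ β * (n : ℝ) ^ β := by
          push_cast
          rw [Real.mul_rpow (by norm_num) hn0.le]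
          ring
  · refine IsBigO.trans (IsBigO.of_bound 1 (Eventually.of_forall fun n => ?_)) hβ
    rw [one_mul, Real.norm_of_nonneg (Nat.cast_nonneg _), Real.norm_of_nonneg (Nat.cast_nonneg _)]
    exact_mod_cast tensorRankD_sixTetra_mono_level (le_rectDim_mul_rectDim n δ) (rectDim n δ)

/-- **THE LADDER IS THE FAMILY OF UNBALANCED PRODUCTS**: for `δ ∈ [0,1]`, the admissible exponents of
the sixth-edge family `n ↦ W_n^{(⌈n^δ⌉)}` are exactly those of `n ↦ T(K₄)_{⌈n^δ⌉} ⊠ D_{⌈n^{1−δ}⌉}` —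
`χ(δ)` is the exponent (base `n`) of a tetrahedron of size `n^δ` times a diamond of size `n^{1−δ}`.
Endpoints: `δ = 0` the diamond `D_n` (`ψ`), `δ = 1` the tetrahedron `T(K₄)_n` (`T`); K2's chord
`χ(δ) ≤ δT + (1−δ)ψ` is sub-multiplicativity of rank under `⊠`.
[cite: ChristandlVranaZuiddam2016, §1.1 (graph tensors multiply under ⊠)] -/
theorem sixAdmissibleExponents_eq_tetra_kron_pencil {δ : ℝ} (hδ0 : 0 ≤ δ) (hδ1 : δ ≤ 1) :
    sixAdmissibleExponents F δ =
      {β : ℝ | (fun n : ℕ =>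
          (tensorRankD (fun i : Fin 4 → Fin ((rectDim n δ * rectDim n (1 - δ)) ^ 3) =>
              tetra F (rectDim n δ) (fun v => K₁ (i v)) *
                pencil F (rectDim n (1 - δ)) (rectDim n (1 - δ)) (fun v => K₂ (i v))) : ℝ)) =O[atTop]
        fun n : ℕ => (n : ℝ) ^ β} := by
  rw [sixAdmissibleExponents_eq_unbalanced F hδ0 hδ1]
  ext β
  simp only [Set.mem_setOf_eq]
  refine isBigO_congr ?_ EventuallyEq.rfl
  filter_upwards [eventually_ge_atTop 1] with n hn
  rw [tensorRankD_tetra_kron_pencil (F := F) (rectDim n δ) (rectDim n (1 - δ))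
    (one_le_rectDim hn _)]

end Unbalanced

end Summit.MatrixMultiplication.MatrixMultiplication.Theorems.EdgePencil

end
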